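/-
Copyright (c) 2026 the pub-hodgecm-mathlib formalisation cell (harness21).  Prover seat hodgecm-mathlib-K2E3-p34 (g0), HCML Track B «K2-LIT» (close-out strike line L4
`stub_StCharTS`), h413 = `stmt-HodgeConjecture-24833`, line `K2_E3_EllipticInputs`, PART «SC» socket (SC-an)₂ `sig_K2E3SupercuspidalTruncatedCharAnalyticTwo`, the (M5h₂)
chain (dealer K2E3-plan (g4) deal D150 2026-09-04T15:07:43Z): the `U(1,1)` twin (M5e-1)₂ of ★ p856957∕p856981 `K2E3SupercuspBallBoundSplitAssembly` (K2E3-p14 (g3)) —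
THE SPLIT-REGULAR BALL BOUND FOR A TRUNCATED COEFFICIENT ON `U(σ, Φ₂)(K)`, ASSEMBLY.  2026-09-04.
-/
import Summits.HodgeConjecture.HodgeConjecture.Theorems.K2E3TruncatedCharTorusSlicingTwo         -- ★ (M5b)₂ p861269 (K2E3-p35): `integral_heightBall_norm_conj_le` (the `A`-volume slicing), `measure_torusU_heightBall_zero_lt_top`, `torusU_comm_of_glDiagonal`; brings ★ (D2)₂ p861205 (this seat): (D2a) `exists_conjugator_mem_heightBall`, `mem_heightBall_torus_of_conj_mem`, ★ U2Torus, ★ `unfoldingConstant`, ★ `descConj`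
import Summits.HodgeConjecture.HodgeConjecture.Theorems.K2E3SplitTorusOrbitalBoundRankOneTwo     -- ★ (M5a)₂ p861220 (K2E3-p28): `exists_const_lintegral_descConj_torusU_le` (Theorem 14 on the split torus of `U(σ, Φ₂)`, one-factor module)
import Summits.HodgeConjecture.HodgeConjecture.Theorems.K2E3SplitTorusTwistModuleBoundTwo         -- ★ p861178 (K2E1-p12): `twistModule_le_pow_mul_inv_sqrt_prod` (`J(t) ≤ q^m (√|d₀−d₁|)⁻¹`), `normAbs_det_torus_eq_one`; brings ★ `HeisRing.skewModulus`, ★ `LineRing.map_unit_torusScalar_sub_one_two`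
import Summits.HodgeConjecture.HodgeConjecture.Theorems.K2E3SplitTorusDepthFromDiscriminantTwo    -- ★ p861199 (K2E3-p33): `charpoly_discr_coe_glDiagonal` (`= (d₁−d₀)²`), `det_coe_glDiagonal`, `v_pow_le_v_sub_of_pow_normAbs_le_token` (depth `4τ + 4m`)
import HarnessLib

/-!
# K2_E3 road (h413), socket (SC-an)₂, (M5h₂) chain piece (M5e-1)₂: THE SPLIT-REGULAR BALL BOUND FOR A TRUNCATED COEFFICIENT ON `U(σ, Φ₂)(K)` — ASSEMBLY

Harish-Chandra, *Harmonic analysis on reductive p-adic groups* (1970), Part VII §3 pp. 71–72 (the estimate `|Θ_T(γ^y)| ≤ c (1+|λ(γ)|)^r |D(γ)|^{-1∕2}` behind Theorem 19∕20)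
at rank one, on the MODEL group `U = U(σ, Φ₂)(K)` (a unitary group in TWO variables) with its diagonal split torus `T = torusU σ Φ₂ = {d(α, σ(α)⁻¹)}`.  This file is the
`Fin 3 ↦ Fin 2` twin of ★ (M5e-1) `K2E3SupercuspBallBoundSplitAssembly` and, like it, only ASSEMBLES bricks:

* ★ (D2a)₂ `K2E3ConjugatorHeightControlRankOneTwo.exists_conjugator_mem_heightBall` (this seat): a split-regular `g = y t y⁻¹ ∈ Ω_m` of depth `λ` has a conjugator
  `y₀ ∈ Ω_{2m+2λ}` (★ `N = 3` currency; the sharp `2 × 2` radius is `m + λ`);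
* ★ (M5b)₂ `K2E3TruncatedCharTorusSlicingTwo.integral_heightBall_norm_conj_le` (K2E3-p35, ★ p861269): `∫_{Ω R} ‖θ(x g x⁻¹)‖ dμ ≤ ((2(R+s+2m_θ+2λ)+1) · ρ(T ∩ Ω₀) · ∫_{U⧸T} ‖θ(ẋ t ẋ⁻¹)‖ dμQ) ∕ c`;
* ★ (M5a)₂ `K2E3SplitTorusOrbitalBoundRankOneTwo.exists_const_lintegral_descConj_torusU_le` (K2E3-p28, ★ p861220): `∫_{U⧸T} Θ(ẋ t ẋ⁻¹) dμQ ≤ C · M · J(t)` uniformly in the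
  regular `t ∈ T` (Theorem 14, split torus), `J(t) = χ⁻(b−1)⁻¹` the ONE-factor rank-one module of ★ `LineRing.lintegral_conj_eq_mul_lintegral_mul_two`;
* ★ `K2E3SplitTorusTwistModuleBoundTwo.twistModule_le_pow_mul_inv_sqrt_prod` (K2E1-p12): `J(t) ≤ q^m · (√|d₀ − d₁|)⁻¹` on `Ω_m`, and ★ (M5e-2)₂ (K2E3-p33): `discr χ_{diag d} = (d₁−d₀)²`,
  `det = d₀d₁`, depth `λ ≤ 4τ + 4m` on the shell `‖ϖ‖^τ ≤ T`.

ALL FIVE BRICKS ARE ★ (no letters): the file was typed hypothesis-first while (M5a)₂∕(M5b)₂ flew (dealer 15:07:43Z) and docked on their ★ heads BY NAME before filing; every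
head below carries the template's name and binders verbatim (`hunimod`, `K₁`, `hKB`, `hμQ`, `hρ`, `mθ`), so the consumers ((M5h)₂ payer, SplitBallPlace₂, WeightKitPlace₂)
port their ★ `N = 3` calls token for token.

WHAT CHANGES FROM `N = 3` (honest 2 × 2 algebra).  (i) ONE regularity binder `hb : IsUnit (d₀⁻¹d₁ − 1)` and NO `‖a − 1‖_K` factor: the module is
`tw₂ = ((HeisRing.skewModulus σ hσc hb.unit (LineRing.map_unit_torusScalar_sub_one_two σ hJ t hd hb))⁻¹ : ℝ≥0)`; (ii) §3's `√∏_{i<j}|d_i − d_j|` is the single factor `√|d₀ − d₁|`;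
(iii) §4's token identity reads `√√(|(d₁−d₀)²| · |d₀d₁|⁻²) = √|d₀ − d₁|`; (iv) the head constant `2 (R + 2m + 2m_θ + 4λ) + 1` is UNCHANGED (currency (D2a)₂ `s = 2m + 2λ` and the
verbatim slicing constant); (v) the SHELL: ★ (M5e-2)₂ gives depth `4τ + 4m` (not `4τ + 10m`), so the honest shell constant is `2 (R + 18m + 2m_θ + 16τ) + 1`; the ★ `N = 3`
FROZEN-CURRENCY corollary `…_shell_frozen` with `2 (R + 42m + 2m_θ + 16τ) + 1` (weaker) is exported too, for consumers typed against the template's constants.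

Results (all on the model, in the squad's frozen currency — `Ω` the height exhaustion with `hmem`∕`hinv`∕`hmul`, depth `hreg`):
* §1 `isUnit_ratio_sub_one_of_depth` — bookkeeping (depth `λ` ⇒ `t` regular; the template's rank-blind `hasCompactSupport_of_support_subset` is not repeated, gate rule `dedup.landed`);
* §2 `exists_const_integral_heightBall_norm_conj_le` — ONE constant `C` with, for every continuous `θ` supported in `Ω_{m_θ}` and bounded by `M`, every split-regular
  `g = y t y⁻¹ ∈ Ω_m` (`t = diag d` of depth `λ`, `b − 1` a unit) and every radius `R`: `∫_{Ω R} ‖θ(x g x⁻¹)‖ dμ ≤ C · M · (2(R + 2m + 2m_θ + 4λ) + 1) · J(t)`;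
* §3 `exists_const_integral_heightBall_norm_conj_le_sqrt_prod` — the same with `J(t)` replaced by `q^m · (√|d₀ − d₁|)⁻¹` (no regularity binder left);
* §4 `sqrt_sqrt_token_eq_sqrt_prod`, `exists_const_integral_heightBall_norm_conj_le_token` — the same in the line's frozen token `T(g) = √√(|discr χ_g| · |det g|⁻²)` computed
  from `g` itself; `v_pow_mul_torus_le_one_of_conj_mem`; `exists_const_integral_heightBall_norm_conj_le_shell` (no depth binder left; honest `18m`) and `…_shell_frozen` (`42m`).

HONEST LABEL.  HC_CM is proved only modulo the 7 printed citations (2 remaining named inputs: hLiu418 = `stmt-HodgeConjecture-24832`, h413 = `stmt-HodgeConjecture-24833`)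
until rung 0 closes; count-neutral helper (an intermediate of (SC-an)₂, not a printed citation of HC_CM); (SC-an)₂ is NOT ★ until the whole (M5h₂) chain lands.

## References
* [HarishChandra1970] Harish-Chandra (notes by G. van Dijk), *Harmonic Analysis on Reductive p-adic Groups*, LNM 162 (1970), Part VI §8 Theorem 14 p. 60; Part VII §2 p. 69,
  Theorem 19 p. 70, §3 pp. 71–72.
* [Rogawski1990] J. D. Rogawski, *Automorphic Representations of Unitary Groups in Three Variables*, Ann. of Math. Stud. 123 (1990), §1.10 p. 9; §3.1 p. 19; §4.9 (4.9.2) p. 55;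
  §7.3 p. 97.
-/

set_option autoImplicit false
set_option linter.dupNamespace false

noncomputable section

open MeasureTheory Measure Set Filter Topology
open scoped NNReal ENNReal Pointwise Matrix MatrixGroups WithZero
open Literature.NumberTheory.Automorphic Literature.NumberTheory.Automorphic.UnitaryGroup
open Literature.NumberTheory.GaloisRepresentations Literature.NumberTheory.GaloisRepresentations.IsNonarchimedeanLocalField
open Literature.MeasureTheory.Group
open Summit.HodgeConjecture.HodgeConjecture.Cruxes.H413.K2E3CuspFormCancellationU2Torus
open Summit.HodgeConjecture.HodgeConjecture.Cruxes.H413.K2E3ConjugatorHeightControlRankOneTwo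
open Summit.HodgeConjecture.HodgeConjecture.Cruxes.H413.K2E3TruncatedCharTorusSlicingTwo
open Summit.HodgeConjecture.HodgeConjecture.Cruxes.H413.K2E3SplitTorusOrbitalBoundRankOneTwo
open Summit.HodgeConjecture.HodgeConjecture.Cruxes.H413.K2E3SplitTorusTwistModuleBoundTwo
open Summit.HodgeConjecture.HodgeConjecture.Cruxes.H413.K2E3SplitTorusDepthFromDiscriminantTwo

namespace Summit.HodgeConjecture.HodgeConjecture.Cruxes.H413.K2E3SupercuspBallBoundSplitAssemblyTwo

/-! ## §1 Bookkeeping: regularity from the depth -/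

section Bookkeeping

variable {K : Type*} [Field K] [Valued K ℤᵐ⁰] {ϖ : K} (hϖ : Valued.v ϖ = WithZero.exp (-1 : ℤ))

include hϖ in
/-- Depth `λ` (`|ϖ^λ| ≤ |d_i − d_k|` for `i ≠ k`) implies that the root value `d₀⁻¹d₁ − 1` of `t = diag d` is a unit, i.e. `t` is regular (the binder `hb` of (M5a)₂; at `N = 2`
there is one root pair). [cite: HarishChandra1970, Part VII §2 p. 69] -/
theorem isUnit_ratio_sub_one_of_depth {d : Fin 2 → Kˣ} {lam : ℕ} (hreg : ∀ i k : Fin 2, i ≠ k → Valued.v (ϖ ^ lam) ≤ Valued.v ((d i : K) - d k)) :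
    IsUnit ((((d 0)⁻¹ * d 1 : Kˣ) : K) - 1) := by
  rw [isUnit_iff_ne_zero]
  intro h0
  have hϖ0 : Valued.v (ϖ ^ lam) ≠ 0 := by
    rw [map_pow, hϖ]; exact pow_ne_zero _ WithZero.coe_ne_zero
  have hsub : (d 0 : K) - d 1 = -(d 0 : K) * ((((d 0)⁻¹ * d 1 : Kˣ) : K) - 1) := by
    rw [Units.val_mul, Units.val_inv_eq_inv_val]; field_simp; ring
  have := hreg 0 1 (by decide)
  rw [hsub, h0, mul_zero, map_zero, le_zero_iff] at this
  exact hϖ0 this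

end Bookkeeping

/-! ## §2 The assembled ball bound in the twist-module currency -/

section Assembly

variable {K : Type*} [Field K] [Valued K ℤᵐ⁰] [ValuativeRel K] [(Valued.v : Valuation K ℤᵐ⁰).Compatible] [IsNonarchimedeanLocalField K]
  [T2Space K] [SecondCountableTopology K] [MeasurableSpace K] [BorelSpace K]
  (σ : K →+* K) (hσ : ∀ x, σ (σ x) = x) (hσc : Continuous σ) (hσv : ∀ x, Valued.v (σ x) = Valued.v x) (hσ1 : ∃ x : K, σ x ≠ x) (h2 : (2 : K) ≠ 0)
  {J : Matrix (Fin 2) (Fin 2) K} (hJ : J = (StdForm.antidiagonal 2).over K) {ϖ : K} (hϖ : Valued.v ϖ = WithZero.exp (-1 : ℤ))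
  [MeasurableSpace ↥(unitaryGroupOfForm σ J)] [BorelSpace ↥(unitaryGroupOfForm σ J)]
  [SecondCountableTopology ↥(unitaryGroupOfForm σ J)] [LocallyCompactSpace ↥(unitaryGroupOfForm σ J)]
  (μ : Measure ↥(unitaryGroupOfForm σ J)) [μ.IsHaarMeasure] [μ.IsMulRightInvariant]
  (ρ : Measure ↥(torusU σ J)) [ρ.IsMulLeftInvariant] [SFinite ρ] [IsFiniteMeasureOnCompacts ρ]
  [MeasurableSpace (↥(unitaryGroupOfForm σ J) ⧸ torusU σ J)] [BorelSpace (↥(unitaryGroupOfForm σ J) ⧸ torusU σ J)]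
  (μQ : Measure (↥(unitaryGroupOfForm σ J) ⧸ torusU σ J))
  [SMulInvariantMeasure ↥(unitaryGroupOfForm σ J) (↥(unitaryGroupOfForm σ J) ⧸ torusU σ J) μQ] [IsFiniteMeasureOnCompacts μQ]
  (Ω : CompactExhaustion ↥(unitaryGroupOfForm σ J))
  (hmem : ∀ (m : ℕ) (g : ↥(unitaryGroupOfForm σ J)), g ∈ Ω m ↔
    (∀ i j, Valued.v (ϖ ^ m * ((g : GL (Fin 2) K) : Matrix (Fin 2) (Fin 2) K) i j) ≤ 1) ∧
      ∀ i j, Valued.v (ϖ ^ m * (((g : GL (Fin 2) K)⁻¹ : GL (Fin 2) K) : Matrix (Fin 2) (Fin 2) K) i j) ≤ 1)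
  (hinv : ∀ (m : ℕ) (g : ↥(unitaryGroupOfForm σ J)), g ∈ Ω m → g⁻¹ ∈ Ω m)
  (hmul : ∀ (a b : ℕ) (g h : ↥(unitaryGroupOfForm σ J)), g ∈ Ω a → h ∈ Ω b → g * h ∈ Ω (a + b))

omit [(Valued.v : Valuation K ℤᵐ⁰).Compatible] in
include hσ hσv hJ hϖ hmem hinv hmul in
/-- **(M5e-1)₂ THE SPLIT-REGULAR BALL BOUND, TWIST-MODULE CURRENCY.**  On `U = U(σ, Φ₂)(K)` with `T` the diagonal torus, `μ` a Haar measure,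
`ρ ≠ 0` left invariant on `T`, `μQ ≠ 0` any `U`-invariant measure on `U ⧸ T` finite on compacta, and (M5a)₂'s frame (`hunimod`, `U = K₁ · B` with `K₁`
compact): for every `m_θ` there is ONE `C : ℝ≥0` such that for every continuous `θ : U → E` supported in
`Ω_{m_θ}` with `‖θ‖ ≤ M`, every `t = diag d ∈ T` (root value `b − 1` a unit) of depth `λ`, every `g = y t y⁻¹ ∈ Ω_m` and every radius `R`:
`∫_{Ω R} ‖θ(x g x⁻¹)‖ dμ ≤ C · M · (2 (R + 2m + 2m_θ + 4λ) + 1) · J(t)`, `J(t) = χ⁻(b−1)⁻¹` the ONE-factor module of ★ `LineRing.lintegral_conj_eq_mul_lintegral_mul_two`.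
Proof: ★ (D2a)₂ gives `y₀ ∈ Ω_{2m+2λ}` with `g = y₀ t y₀⁻¹`; ★ (M5b)₂ slices with `s = 2m + 2λ`; ★ (M5a)₂ bounds the quotient integral; `C = ρ(T ∩ Ω₀) · C_{14} ∕ c`.
[cite: HarishChandra1970, Part VII §3 pp. 71–72; Part VI §8 Theorem 14 p. 60] [cite: Rogawski1990, §7.3 p. 97] -/
theorem exists_const_integral_heightBall_norm_conj_le
    (hunimod : ∀ ν : Measure ↥(unitaryGroupOfForm σ J), ν.IsHaarMeasure → ν.IsMulRightInvariant)
    {K₁ : Subgroup ↥(unitaryGroupOfForm σ J)} (hK₁ : IsCompact (K₁ : Set ↥(unitaryGroupOfForm σ J)))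
    (hKB : ∀ g : ↥(unitaryGroupOfForm σ J), ∃ k ∈ K₁, ∃ b ∈ borelU σ J, g = k * b)
    (hμQ : μQ ≠ 0) (hρ : ρ ≠ 0) (mθ : ℕ) {E : Type*} [NormedAddCommGroup E] :
    ∃ C : ℝ≥0, ∀ (θ : ↥(unitaryGroupOfForm σ J) → E), Continuous θ → (∀ g, θ g ≠ 0 → g ∈ Ω mθ) → ∀ (M : ℝ≥0), (∀ g, ‖θ g‖₊ ≤ M) →
      ∀ (t : ↥(torusU σ J)) (d : Fin 2 → Kˣ) (hd : glDiagonal 2 K d = ((t : ↥(unitaryGroupOfForm σ J)) : GL (Fin 2) K))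
        (hb : IsUnit ((((d 0)⁻¹ * d 1 : Kˣ) : K) - 1))
        (lam : ℕ), (∀ i k : Fin 2, i ≠ k → Valued.v (ϖ ^ lam) ≤ Valued.v ((d i : K) - d k)) →
        ∀ (g y : ↥(unitaryGroupOfForm σ J)) (m : ℕ), g ∈ Ω m → g = y * (t : ↥(unitaryGroupOfForm σ J)) * y⁻¹ → ∀ (R : ℕ),
          ∫ x in Ω R, ‖θ (x * g * x⁻¹)‖ ∂μ ≤
            C * M * ((2 * (R + 2 * m + 2 * mθ + 4 * lam) + 1 : ℕ) : ℝ) *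
              (((HeisRing.skewModulus σ hσc hb.unit (LineRing.map_unit_torusScalar_sub_one_two σ hJ t hd hb))⁻¹ : ℝ≥0) : ℝ) := by
  haveI : IsClosed ((torusU σ J : Subgroup ↥(unitaryGroupOfForm σ J)) : Set ↥(unitaryGroupOfForm σ J)) := isClosed_torusU_of_t1Space σ J
  -- ★ (M5a)₂: the Theorem-14 constant for the compact set `Ω m_θ`
  obtain ⟨C₁, hC₁⟩ := exists_const_lintegral_descConj_torusU_le σ hσc hJ hunimod hK₁ hKB μQ (Ω.isCompact mθ)
  -- the finite torus volume `ρ(T ∩ Ω 0)` and the positive unfolding constant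
  have hρ0fin := (measure_torusU_heightBall_zero_lt_top σ Ω ρ).ne
  set ρ0 : ℝ≥0 := (ρ {a : ↥(torusU σ J) | (a : ↥(unitaryGroupOfForm σ J)) ∈ Ω 0}).toNNReal with hρ0def
  have hρ0 : ρ {a : ↥(torusU σ J) | (a : ↥(unitaryGroupOfForm σ J)) ∈ Ω 0} = (ρ0 : ℝ≥0∞) := (ENNReal.coe_toNNReal hρ0fin).symm
  set c : ℝ≥0 := unfoldingConstant (torusU σ J) ρ μQ μ with hcdef
  have hc0 : c ≠ 0 := (unfoldingConstant_pos (torusU σ J) ρ μQ μ hμQ hρ).ne'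
  refine ⟨ρ0 * C₁ / c, fun θ hθc hθ M hM t d hd hb lam hreg g y m hg hgy R => ?_⟩
  -- ★ (D2a)₂: a conjugator of height `2m + 2λ`
  obtain ⟨y₀, hy₀, hgy₀⟩ := exists_conjugator_mem_heightBall σ hσv hσ hJ hϖ (⇑Ω) hmem hd hreg hg hgy
  have ht : ∀ a ∈ torusU σ J, a * (t : ↥(unitaryGroupOfForm σ J)) = (t : ↥(unitaryGroupOfForm σ J)) * a := torusU_comm_of_glDiagonal σ hd
  -- ★ (M5a)₂ at `Θ = ‖θ‖ₑ`
  have hmeas : Measurable fun g : ↥(unitaryGroupOfForm σ J) => ‖θ g‖ₑ := (continuous_enorm.comp hθc).measurable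
  have hsupp : ∀ g : ↥(unitaryGroupOfForm σ J), ‖θ g‖ₑ ≠ 0 → g ∈ Ω mθ := fun g hg => hθ g (enorm_ne_zero.1 hg)
  have hbdd : ∀ g : ↥(unitaryGroupOfForm σ J), ‖θ g‖ₑ ≤ (M : ℝ≥0∞) := fun g => by
    rw [enorm_eq_nnnorm]; exact ENNReal.coe_le_coe.2 (hM g)
  set tw : ℝ≥0 := ((HeisRing.skewModulus σ hσc hb.unit (LineRing.map_unit_torusScalar_sub_one_two σ hJ t hd hb))⁻¹ : ℝ≥0) with htw
  have hI : ∫⁻ q, descConj (t : ↥(unitaryGroupOfForm σ J)) (torusU σ J) ht (fun g => ‖θ g‖ₑ) q ∂μQ ≤ (C₁ : ℝ≥0∞) * M * tw :=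
    hC₁ _ hmeas hsupp _ hbdd t ht d hd hb
  have hfin : ∫⁻ q, descConj (t : ↥(unitaryGroupOfForm σ J)) (torusU σ J) ht (fun g => ‖θ g‖ₑ) q ∂μQ ≠ ∞ :=
    ne_top_of_le_ne_top (by finiteness) hI
  -- ★ (M5b)₂ with `s = 2m + 2λ`
  have hslice := integral_heightBall_norm_conj_le σ hσv hσ hJ hϖ μ ρ μQ Ω hmem hinv hmul hμQ hρ hθc hθ ht hd hreg hy₀ R hfin
  rw [← hgy₀] at hslice
  refine hslice.trans ?_
  -- compare the two right-hand sides
  have e : 2 * (R + (2 * m + 2 * lam) + 2 * mθ + 2 * lam) + 1 = 2 * (R + 2 * m + 2 * mθ + 4 * lam) + 1 := by ring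
  rw [e, hρ0]
  set N : ℕ := 2 * (R + 2 * m + 2 * mθ + 4 * lam) + 1 with hN
  have hle : ((N : ℝ≥0∞) * (ρ0 : ℝ≥0∞) * ∫⁻ q, descConj (t : ↥(unitaryGroupOfForm σ J)) (torusU σ J) ht (fun g => ‖θ g‖ₑ) q ∂μQ) / (c : ℝ≥0∞) ≤
      (((N : ℝ≥0) * ρ0 * (C₁ * M * tw) / c : ℝ≥0) : ℝ≥0∞) := by
    rw [ENNReal.coe_div hc0]
    refine ENNReal.div_le_div_right ?_ _
    push_cast
    exact mul_le_mul' le_rfl hI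
  refine (ENNReal.toReal_mono ENNReal.coe_ne_top hle).trans_eq ?_
  rw [ENNReal.coe_toReal]
  push_cast
  field_simp

include hσ hσc h2 hσv hσ1 hJ hϖ hmem hinv hmul in
/-- **(M5e-1′)₂ THE SPLIT-REGULAR BALL BOUND, `|D|^{−1∕2}` CURRENCY.**  Same frame; the depth `λ` alone is assumed on `t = diag d` (it forces `t`
regular), and `g ∈ Ω_m` forces `|ϖ^m d₀| ≤ 1` (★ (D2)₂ `mem_heightBall_torus_of_conj_mem`), so ★ `twistModule_le_pow_mul_inv_sqrt_prod` turns `J(t)` into `q^m · (√|d₀−d₁|)⁻¹`: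
`∫_{Ω R} ‖θ(x g x⁻¹)‖ dμ ≤ C · M · (2 (R + 2m + 2m_θ + 4λ) + 1) · q^m · (√|d₀ − d₁|)⁻¹` — Harish-Chandra's `c (1+|λ(γ)|)^r |D(γ)|^{−1∕2}` with every exponent explicit and
linear. [cite: HarishChandra1970, Part VII §3 pp. 71–72; Part VI §8 Theorem 14 p. 60] [cite: Rogawski1990, §4.9 (4.9.2) p. 55; §7.3 p. 97] -/
theorem exists_const_integral_heightBall_norm_conj_le_sqrt_prod
    (hunimod : ∀ ν : Measure ↥(unitaryGroupOfForm σ J), ν.IsHaarMeasure → ν.IsMulRightInvariant)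
    {K₁ : Subgroup ↥(unitaryGroupOfForm σ J)} (hK₁ : IsCompact (K₁ : Set ↥(unitaryGroupOfForm σ J)))
    (hKB : ∀ g : ↥(unitaryGroupOfForm σ J), ∃ k ∈ K₁, ∃ b ∈ borelU σ J, g = k * b)
    (hμQ : μQ ≠ 0) (hρ : ρ ≠ 0) (mθ : ℕ) {E : Type*} [NormedAddCommGroup E] :
    ∃ C : ℝ≥0, ∀ (θ : ↥(unitaryGroupOfForm σ J) → E), Continuous θ → (∀ g, θ g ≠ 0 → g ∈ Ω mθ) → ∀ (M : ℝ≥0), (∀ g, ‖θ g‖₊ ≤ M) →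
      ∀ (t : ↥(torusU σ J)) (d : Fin 2 → Kˣ), glDiagonal 2 K d = ((t : ↥(unitaryGroupOfForm σ J)) : GL (Fin 2) K) →
        ∀ (lam : ℕ), (∀ i k : Fin 2, i ≠ k → Valued.v (ϖ ^ lam) ≤ Valued.v ((d i : K) - d k)) →
        ∀ (g y : ↥(unitaryGroupOfForm σ J)) (m : ℕ), g ∈ Ω m → g = y * (t : ↥(unitaryGroupOfForm σ J)) * y⁻¹ → ∀ (R : ℕ),
          ∫ x in Ω R, ‖θ (x * g * x⁻¹)‖ ∂μ ≤
            C * M * ((2 * (R + 2 * m + 2 * mθ + 4 * lam) + 1 : ℕ) : ℝ) * ((residueFieldCard K : ℝ≥0) : ℝ) ^ m *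
              ((NNReal.sqrt (normAbs K ((d 0 : K) - d 1)))⁻¹ : ℝ) := by
  obtain ⟨C, hC⟩ := exists_const_integral_heightBall_norm_conj_le σ hσ hσc hσv hJ hϖ μ ρ μQ Ω hmem hinv hmul hunimod hK₁ hKB hμQ hρ mθ (E := E)
  refine ⟨C, fun θ hθc hθ M hM t d hd lam hreg g y m hg hgy R => ?_⟩
  have hb : IsUnit ((((d 0)⁻¹ * d 1 : Kˣ) : K) - 1) := isUnit_ratio_sub_one_of_depth hϖ hreg
  refine (hC θ hθc hθ M hM t d hd hb lam hreg g y m hg hgy R).trans ?_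
  -- `t ∈ Ω m` (★ §2 of (D2)₂), hence `|ϖ^m d₀| ≤ 1`
  have htΩ : (t : ↥(unitaryGroupOfForm σ J)) ∈ (⇑Ω) m :=
    mem_heightBall_torus_of_conj_mem σ hσv hJ (⇑Ω) hmem hd (x := y) (by rw [← hgy]; exact hg)
  have hm : Valued.v (ϖ ^ m * (d 0 : K)) ≤ 1 := ((diag_mem_heightBall_iff σ hσv hJ (⇑Ω) hmem hd m).1 htΩ).1
  have hJle := twistModule_le_pow_mul_inv_sqrt_prod σ hσ hσc hσ1 h2 hJ hϖ t hd hb hm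
  rw [mul_assoc (C * M * _ : ℝ)]
  refine mul_le_mul_of_nonneg_left ?_ (by positivity)
  exact_mod_cast hJle

end Assembly

/-! ## §4 The same bound in the line's frozen token `T(g) = √√(|discr χ_g| · |det g|⁻²)` -/

section Token

variable {K : Type*} [Field K] [Valued K ℤᵐ⁰] [ValuativeRel K] [(Valued.v : Valuation K ℤᵐ⁰).Compatible] [IsNonarchimedeanLocalField K]
  (σ : K →+* K) (hσv : ∀ x, Valued.v (σ x) = Valued.v x) {J : Matrix (Fin 2) (Fin 2) K} (hJ : J = (StdForm.antidiagonal 2).over K)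

include hσv hJ in
/-- **THE TOKEN AT A TORUS ELEMENT**: for `t = diag d ∈ T ≤ U(σ, Φ₂)(K)` one has `|det t| = |d₀d₁| = 1` (★ `normAbs_det_torus_eq_one`) and `discr χ_t = (d₁−d₀)²`
(★ `charpoly_discr_coe_glDiagonal`), so the line's frozen token `T(t) = √√(|discr χ_t| · |det t|⁻²)` equals `√|d₀ − d₁|` = Harish-Chandra's `|D(t)|^{1∕2}` at rank one.
[cite: HarishChandra1970, Part VII §2 p. 69] [cite: Rogawski1990, §3.1 p. 19; §4.9 (4.9.2) p. 55] -/
theorem sqrt_sqrt_token_eq_sqrt_prod (t : ↥(torusU σ J)) {d : Fin 2 → Kˣ} (hd : glDiagonal 2 K d = ((t : ↥(unitaryGroupOfForm σ J)) : GL (Fin 2) K)) :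
    NNReal.sqrt (NNReal.sqrt
      (normAbs K (((glDiagonal 2 K d : GL (Fin 2) K) : Matrix (Fin 2) (Fin 2) K)).charpoly.discr *
        (normAbs K (((glDiagonal 2 K d : GL (Fin 2) K) : Matrix (Fin 2) (Fin 2) K)).det ^ 2)⁻¹)) =
      NNReal.sqrt (normAbs K ((d 0 : K) - d 1)) := by
  have hrel := torus_rel σ hJ hd
  have hX : normAbs K ((((d 1 : K) - d 0)) ^ 2) = (normAbs K ((d 0 : K) - d 1)) ^ 2 := by
    rw [map_pow, ← neg_sub (d 0 : K) (d 1), normAbs_neg]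
  rw [charpoly_discr_coe_glDiagonal, det_coe_glDiagonal, normAbs_det_torus_eq_one σ hσv hrel, one_pow, inv_one, mul_one, hX, NNReal.sqrt_sq]

variable [T2Space K] [SecondCountableTopology K] [MeasurableSpace K] [BorelSpace K]
  (hσ : ∀ x, σ (σ x) = x) (hσc : Continuous σ) (hσ1 : ∃ x : K, σ x ≠ x) (h2 : (2 : K) ≠ 0)
  {ϖ : K} (hϖ : Valued.v ϖ = WithZero.exp (-1 : ℤ))
  [MeasurableSpace ↥(unitaryGroupOfForm σ J)] [BorelSpace ↥(unitaryGroupOfForm σ J)]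
  [SecondCountableTopology ↥(unitaryGroupOfForm σ J)] [LocallyCompactSpace ↥(unitaryGroupOfForm σ J)]
  (μ : Measure ↥(unitaryGroupOfForm σ J)) [μ.IsHaarMeasure] [μ.IsMulRightInvariant]
  (ρ : Measure ↥(torusU σ J)) [ρ.IsMulLeftInvariant] [SFinite ρ] [IsFiniteMeasureOnCompacts ρ]
  [MeasurableSpace (↥(unitaryGroupOfForm σ J) ⧸ torusU σ J)] [BorelSpace (↥(unitaryGroupOfForm σ J) ⧸ torusU σ J)]
  (μQ : Measure (↥(unitaryGroupOfForm σ J) ⧸ torusU σ J))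
  [SMulInvariantMeasure ↥(unitaryGroupOfForm σ J) (↥(unitaryGroupOfForm σ J) ⧸ torusU σ J) μQ] [IsFiniteMeasureOnCompacts μQ]
  (Ω : CompactExhaustion ↥(unitaryGroupOfForm σ J))
  (hmem : ∀ (m : ℕ) (g : ↥(unitaryGroupOfForm σ J)), g ∈ Ω m ↔
    (∀ i j, Valued.v (ϖ ^ m * ((g : GL (Fin 2) K) : Matrix (Fin 2) (Fin 2) K) i j) ≤ 1) ∧
      ∀ i j, Valued.v (ϖ ^ m * (((g : GL (Fin 2) K)⁻¹ : GL (Fin 2) K) : Matrix (Fin 2) (Fin 2) K) i j) ≤ 1)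
  (hinv : ∀ (m : ℕ) (g : ↥(unitaryGroupOfForm σ J)), g ∈ Ω m → g⁻¹ ∈ Ω m)
  (hmul : ∀ (a b : ℕ) (g h : ↥(unitaryGroupOfForm σ J)), g ∈ Ω a → h ∈ Ω b → g * h ∈ Ω (a + b))

include hσ hσc h2 hσv hσ1 hJ hϖ hmem hinv hmul in
/-- **(M5e-1″)₂ THE SPLIT-REGULAR BALL BOUND IN THE FROZEN TOKEN `T(g)`** — the `hball` weight of the (M5h)₂ domination on the split-regular locus of
the model: ONE `C` per `m_θ` with, for every continuous `θ` supported in `Ω_{m_θ}`, `‖θ‖ ≤ M`, every split-regular `g = y t y⁻¹ ∈ Ω_m` (`t = diag d` of depth `λ`) and every `R`,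
`∫_{Ω R} ‖θ(x g x⁻¹)‖ dμ ≤ C · M · (2 (R + 2m + 2m_θ + 4λ) + 1) · q^m · T(g)⁻¹`, `T(g) = √√(|discr χ_g|_K · |det g|_K⁻²)` computed from `g` ITSELF (`χ` and `det` are
conjugation invariant, `sqrt_sqrt_token_eq_sqrt_prod`). [cite: HarishChandra1970, Part VII §3 pp. 71–72, Theorem 19 p. 70; Part VI §8 Theorem 14 p. 60] [cite: Rogawski1990, §7.3 p. 97] -/
theorem exists_const_integral_heightBall_norm_conj_le_token
    (hunimod : ∀ ν : Measure ↥(unitaryGroupOfForm σ J), ν.IsHaarMeasure → ν.IsMulRightInvariant)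
    {K₁ : Subgroup ↥(unitaryGroupOfForm σ J)} (hK₁ : IsCompact (K₁ : Set ↥(unitaryGroupOfForm σ J)))
    (hKB : ∀ g : ↥(unitaryGroupOfForm σ J), ∃ k ∈ K₁, ∃ b ∈ borelU σ J, g = k * b)
    (hμQ : μQ ≠ 0) (hρ : ρ ≠ 0) (mθ : ℕ) {E : Type*} [NormedAddCommGroup E] :
    ∃ C : ℝ≥0, ∀ (θ : ↥(unitaryGroupOfForm σ J) → E), Continuous θ → (∀ g, θ g ≠ 0 → g ∈ Ω mθ) → ∀ (M : ℝ≥0), (∀ g, ‖θ g‖₊ ≤ M) →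
      ∀ (t : ↥(torusU σ J)) (d : Fin 2 → Kˣ), glDiagonal 2 K d = ((t : ↥(unitaryGroupOfForm σ J)) : GL (Fin 2) K) →
        ∀ (lam : ℕ), (∀ i k : Fin 2, i ≠ k → Valued.v (ϖ ^ lam) ≤ Valued.v ((d i : K) - d k)) →
        ∀ (g y : ↥(unitaryGroupOfForm σ J)) (m : ℕ), g ∈ Ω m → g = y * (t : ↥(unitaryGroupOfForm σ J)) * y⁻¹ → ∀ (R : ℕ),
          ∫ x in Ω R, ‖θ (x * g * x⁻¹)‖ ∂μ ≤
            C * M * ((2 * (R + 2 * m + 2 * mθ + 4 * lam) + 1 : ℕ) : ℝ) * ((residueFieldCard K : ℝ≥0) : ℝ) ^ m *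
              ((NNReal.sqrt (NNReal.sqrt
                (normAbs K (((g : GL (Fin 2) K) : Matrix (Fin 2) (Fin 2) K)).charpoly.discr *
                  (normAbs K (((g : GL (Fin 2) K) : Matrix (Fin 2) (Fin 2) K)).det ^ 2)⁻¹)))⁻¹ : ℝ) := by
  obtain ⟨C, hC⟩ := exists_const_integral_heightBall_norm_conj_le_sqrt_prod σ hσ hσc hσv hσ1 h2 hJ hϖ μ ρ μQ Ω hmem hinv hmul hunimod hK₁ hKB hμQ hρ mθ (E := E)
  refine ⟨C, fun θ hθc hθ M hM t d hd lam hreg g y m hg hgy R => ?_⟩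
  -- `χ_g = χ_t`, `det g = det t` (conjugation invariance), then §4's token identity
  have hcoe : (g : GL (Fin 2) K) = (y : GL (Fin 2) K) * (glDiagonal 2 K d : GL (Fin 2) K) * (y : GL (Fin 2) K)⁻¹ := by
    rw [hgy, hd]; rfl
  have hchar : (((g : GL (Fin 2) K) : Matrix (Fin 2) (Fin 2) K)).charpoly = (((glDiagonal 2 K d : GL (Fin 2) K) : Matrix (Fin 2) (Fin 2) K)).charpoly := by
    rw [hcoe, Units.val_mul, Units.val_mul, Matrix.coe_units_inv]
    exact Matrix.charpoly_units_conj (y : GL (Fin 2) K) _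
  have hdet : (((g : GL (Fin 2) K) : Matrix (Fin 2) (Fin 2) K)).det = (((glDiagonal 2 K d : GL (Fin 2) K) : Matrix (Fin 2) (Fin 2) K)).det := by
    rw [hcoe, Units.val_mul, Units.val_mul]
    exact Matrix.det_units_conj (y : GL (Fin 2) K) _
  rw [hchar, hdet, sqrt_sqrt_token_eq_sqrt_prod σ hσv hJ t hd]
  exact hC θ hθc hθ M hM t d hd lam hreg g y m hg hgy R

omit [ValuativeRel K] [(Valued.v : Valuation K ℤᵐ⁰).Compatible] [IsNonarchimedeanLocalField K] [T2Space K] [SecondCountableTopology K] [MeasurableSpace K]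
  [BorelSpace K] [MeasurableSpace ↥(unitaryGroupOfForm σ J)] [BorelSpace ↥(unitaryGroupOfForm σ J)] [SecondCountableTopology ↥(unitaryGroupOfForm σ J)]
  [LocallyCompactSpace ↥(unitaryGroupOfForm σ J)] [MeasurableSpace (↥(unitaryGroupOfForm σ J) ⧸ torusU σ J)] [BorelSpace (↥(unitaryGroupOfForm σ J) ⧸ torusU σ J)] in
include hσv hJ hmem in
/-- **ON `Ω_m` THE TORUS ENTRIES ARE CONTROLLED**: if `t = diag d` is conjugate into `Ω_m` (`y t y⁻¹ ∈ Ω_m`) then `|ϖ^m d_i| ≤ 1` and `|ϖ^m d_i⁻¹| ≤ 1` for every `i`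
(★ (D2)₂ `mem_heightBall_torus_of_conj_mem`, then the diagonal entries of `t^{±1}` through `hmem`; no `hϖ` needed at `N = 2`). [cite: HarishChandra1970, Part VII §2 p. 69] -/
theorem v_pow_mul_torus_le_one_of_conj_mem {t y : ↥(unitaryGroupOfForm σ J)} {d : Fin 2 → Kˣ} (hd : glDiagonal 2 K d = (t : GL (Fin 2) K))
    {m : ℕ} (hg : y * t * y⁻¹ ∈ Ω m) (i : Fin 2) :
    Valued.v (ϖ ^ m * (d i : K)) ≤ 1 ∧ Valued.v (ϖ ^ m * ((d i : K))⁻¹) ≤ 1 := by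
  have htΩ : t ∈ (⇑Ω) m := mem_heightBall_torus_of_conj_mem σ hσv hJ (⇑Ω) hmem hd hg
  obtain ⟨hA, hB⟩ := (hmem m t).1 htΩ
  refine ⟨?_, ?_⟩
  · have := hA i i
    rwa [← hd, coe_glDiagonal, Matrix.diagonal_apply_eq] at this
  · have := hB i i
    rwa [← hd, K2E3CuspFormCancellationU3Torus.coe_inv_glDiagonal, Matrix.diagonal_apply_eq] at this

include hσ hσc h2 hσv hσ1 hJ hϖ hmem hinv hmul in
/-- **(M5e-1‴)₂ THE SHELL FORM — NO DEPTH BINDER LEFT, HONEST `2 × 2` CONSTANTS.**  On the shell `T(g) ≥ ‖ϖ‖^τ` of the height ball `Ω_m`, ★ (M5e-2)₂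
`v_pow_le_v_sub_of_pow_normAbs_le_token` says `t` has depth `λ := 4τ + 4m` (at `N = 3`: `4τ + 10m`), so (M5e-1″)₂ reads, for every continuous `θ` supported in `Ω_{m_θ}` with
`‖θ‖ ≤ M`, every split `g = y t y⁻¹ ∈ Ω_m` with `‖ϖ‖^τ ≤ T(g)`, every `R`: `∫_{Ω R} ‖θ(x g x⁻¹)‖ dμ ≤ C · M · (2 (R + 18m + 2m_θ + 16τ) + 1) · q^m · T(g)⁻¹` — the right-hand
side is a function of `(m, m_θ, R, τ, T(g))` alone: the weight `W` the (M5h)₂ assembler packages.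
[cite: HarishChandra1970, Part VII §3 pp. 71–72, Theorem 19 p. 70; Part VI §8 Theorem 14 p. 60] [cite: Rogawski1990, §7.3 p. 97] -/
theorem exists_const_integral_heightBall_norm_conj_le_shell
    (hunimod : ∀ ν : Measure ↥(unitaryGroupOfForm σ J), ν.IsHaarMeasure → ν.IsMulRightInvariant)
    {K₁ : Subgroup ↥(unitaryGroupOfForm σ J)} (hK₁ : IsCompact (K₁ : Set ↥(unitaryGroupOfForm σ J)))
    (hKB : ∀ g : ↥(unitaryGroupOfForm σ J), ∃ k ∈ K₁, ∃ b ∈ borelU σ J, g = k * b)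
    (hμQ : μQ ≠ 0) (hρ : ρ ≠ 0) (mθ : ℕ) {E : Type*} [NormedAddCommGroup E] :
    ∃ C : ℝ≥0, ∀ (θ : ↥(unitaryGroupOfForm σ J) → E), Continuous θ → (∀ g, θ g ≠ 0 → g ∈ Ω mθ) → ∀ (M : ℝ≥0), (∀ g, ‖θ g‖₊ ≤ M) →
      ∀ (t : ↥(torusU σ J)) (d : Fin 2 → Kˣ), glDiagonal 2 K d = ((t : ↥(unitaryGroupOfForm σ J)) : GL (Fin 2) K) →
        ∀ (g y : ↥(unitaryGroupOfForm σ J)) (m : ℕ), g ∈ Ω m → g = y * (t : ↥(unitaryGroupOfForm σ J)) * y⁻¹ →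
        ∀ (τ : ℕ), normAbs K ϖ ^ τ ≤ NNReal.sqrt (NNReal.sqrt
            (normAbs K (((g : GL (Fin 2) K) : Matrix (Fin 2) (Fin 2) K)).charpoly.discr *
              (normAbs K (((g : GL (Fin 2) K) : Matrix (Fin 2) (Fin 2) K)).det ^ 2)⁻¹)) → ∀ (R : ℕ),
          ∫ x in Ω R, ‖θ (x * g * x⁻¹)‖ ∂μ ≤
            C * M * ((2 * (R + 18 * m + 2 * mθ + 16 * τ) + 1 : ℕ) : ℝ) * ((residueFieldCard K : ℝ≥0) : ℝ) ^ m *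
              ((NNReal.sqrt (NNReal.sqrt
                (normAbs K (((g : GL (Fin 2) K) : Matrix (Fin 2) (Fin 2) K)).charpoly.discr *
                  (normAbs K (((g : GL (Fin 2) K) : Matrix (Fin 2) (Fin 2) K)).det ^ 2)⁻¹)))⁻¹ : ℝ) := by
  obtain ⟨C, hC⟩ := exists_const_integral_heightBall_norm_conj_le_token σ hσv hJ hσ hσc hσ1 h2 hϖ μ ρ μQ Ω hmem hinv hmul hunimod hK₁ hKB hμQ hρ mθ (E := E)
  refine ⟨C, fun θ hθc hθ M hM t d hd g y m hg hgy τ hτ R => ?_⟩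
  -- the token of `g` is the token of `diag d` (conjugation invariance, as in (M5e-1″)₂)
  have hcoe : (g : GL (Fin 2) K) = (y : GL (Fin 2) K) * (glDiagonal 2 K d : GL (Fin 2) K) * (y : GL (Fin 2) K)⁻¹ := by
    rw [hgy, hd]; rfl
  have hchar : (((g : GL (Fin 2) K) : Matrix (Fin 2) (Fin 2) K)).charpoly = (((glDiagonal 2 K d : GL (Fin 2) K) : Matrix (Fin 2) (Fin 2) K)).charpoly := by
    rw [hcoe, Units.val_mul, Units.val_mul, Matrix.coe_units_inv]
    exact Matrix.charpoly_units_conj (y : GL (Fin 2) K) _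
  have hdet : (((g : GL (Fin 2) K) : Matrix (Fin 2) (Fin 2) K)).det = (((glDiagonal 2 K d : GL (Fin 2) K) : Matrix (Fin 2) (Fin 2) K)).det := by
    rw [hcoe, Units.val_mul, Units.val_mul]
    exact Matrix.det_units_conj (y : GL (Fin 2) K) _
  rw [hchar, hdet] at hτ
  -- the torus entries on `Ω m`, then ★ (M5e-2)₂: depth `4τ + 4m`
  have hgt : y * (t : ↥(unitaryGroupOfForm σ J)) * y⁻¹ ∈ Ω m := by rw [← hgy]; exact hg
  have hdm' := fun i => (v_pow_mul_torus_le_one_of_conj_mem σ hσv hJ Ω hmem hd hgt i).2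
  have hreg : ∀ i k : Fin 2, i ≠ k → Valued.v (ϖ ^ (4 * τ + 4 * m)) ≤ Valued.v ((d i : K) - d k) := fun i k hik =>
    v_pow_le_v_sub_of_pow_normAbs_le_token hϖ hdm' hτ hik
  have e : 2 * (R + 2 * m + 2 * mθ + 4 * (4 * τ + 4 * m)) + 1 = 2 * (R + 18 * m + 2 * mθ + 16 * τ) + 1 := by ring
  rw [← e]
  exact hC θ hθc hθ M hM t d hd (4 * τ + 4 * m) hreg g y m hg hgy R

include hσ hσc h2 hσv hσ1 hJ hϖ hmem hinv hmul in
/-- **(M5e-1‴)₂ THE SHELL FORM IN THE ★ `N = 3` FROZEN CURRENCY** — the same with the template's constant `2 (R + 42m + 2m_θ + 16τ) + 1` (weaker than the honest `18m`, since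
`18 ≤ 42`), for consumers typed token-for-token against ★ (M5e-1‴) (K2E3-p23's (SHELL₂) letter, the SplitBallPlace₂∕WeightKitPlace₂ ports).
[cite: HarishChandra1970, Part VII §3 pp. 71–72, Theorem 19 p. 70] [cite: Rogawski1990, §7.3 p. 97] -/
theorem exists_const_integral_heightBall_norm_conj_le_shell_frozen
    (hunimod : ∀ ν : Measure ↥(unitaryGroupOfForm σ J), ν.IsHaarMeasure → ν.IsMulRightInvariant)
    {K₁ : Subgroup ↥(unitaryGroupOfForm σ J)} (hK₁ : IsCompact (K₁ : Set ↥(unitaryGroupOfForm σ J)))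
    (hKB : ∀ g : ↥(unitaryGroupOfForm σ J), ∃ k ∈ K₁, ∃ b ∈ borelU σ J, g = k * b)
    (hμQ : μQ ≠ 0) (hρ : ρ ≠ 0) (mθ : ℕ) {E : Type*} [NormedAddCommGroup E] :
    ∃ C : ℝ≥0, ∀ (θ : ↥(unitaryGroupOfForm σ J) → E), Continuous θ → (∀ g, θ g ≠ 0 → g ∈ Ω mθ) → ∀ (M : ℝ≥0), (∀ g, ‖θ g‖₊ ≤ M) →
      ∀ (t : ↥(torusU σ J)) (d : Fin 2 → Kˣ), glDiagonal 2 K d = ((t : ↥(unitaryGroupOfForm σ J)) : GL (Fin 2) K) →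
        ∀ (g y : ↥(unitaryGroupOfForm σ J)) (m : ℕ), g ∈ Ω m → g = y * (t : ↥(unitaryGroupOfForm σ J)) * y⁻¹ →
        ∀ (τ : ℕ), normAbs K ϖ ^ τ ≤ NNReal.sqrt (NNReal.sqrt
            (normAbs K (((g : GL (Fin 2) K) : Matrix (Fin 2) (Fin 2) K)).charpoly.discr *
              (normAbs K (((g : GL (Fin 2) K) : Matrix (Fin 2) (Fin 2) K)).det ^ 2)⁻¹)) → ∀ (R : ℕ),
          ∫ x in Ω R, ‖θ (x * g * x⁻¹)‖ ∂μ ≤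
            C * M * ((2 * (R + 42 * m + 2 * mθ + 16 * τ) + 1 : ℕ) : ℝ) * ((residueFieldCard K : ℝ≥0) : ℝ) ^ m *
              ((NNReal.sqrt (NNReal.sqrt
                (normAbs K (((g : GL (Fin 2) K) : Matrix (Fin 2) (Fin 2) K)).charpoly.discr *
                  (normAbs K (((g : GL (Fin 2) K) : Matrix (Fin 2) (Fin 2) K)).det ^ 2)⁻¹)))⁻¹ : ℝ) := by
  obtain ⟨C, hC⟩ := exists_const_integral_heightBall_norm_conj_le_shell σ hσv hJ hσ hσc hσ1 h2 hϖ μ ρ μQ Ω hmem hinv hmul hunimod hK₁ hKB hμQ hρ mθ (E := E)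
  refine ⟨C, fun θ hθc hθ M hM t d hd g y m hg hgy τ hτ R => (hC θ hθc hθ M hM t d hd g y m hg hgy τ hτ R).trans ?_⟩
  have hle : ((2 * (R + 18 * m + 2 * mθ + 16 * τ) + 1 : ℕ) : ℝ) ≤ ((2 * (R + 42 * m + 2 * mθ + 16 * τ) + 1 : ℕ) : ℝ) := by
    exact_mod_cast (by omega : 2 * (R + 18 * m + 2 * mθ + 16 * τ) + 1 ≤ 2 * (R + 42 * m + 2 * mθ + 16 * τ) + 1)
  gcongr

end Token

end Summit.HodgeConjecture.HodgeConjecture.Cruxes.H413.K2E3SupercuspBallBoundSplitAssemblyTwo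

end
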